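import Summits.QuantumFields.BalabanUV.Beta.D1BFx.RJetProjector
import Summits.QuantumFields.BalabanUV.Beta.D1BFx.BlockColumnSupNorm

/-!
# `BalabanUV.Beta.D1BFx.ProjectorSupNorm` — road «BF-x» for binder row D1, sub-leaf **A3.a-P** (part 3 of 3):
# THE SHARP SUP-NORM BOUND FOR BAŁABAN'S GAUGE-TERM PROJECTOR `P = G′Q′*(Q′G′²Q′*)⁻¹Q′G′` on `ℤ^d`:
# `|P(p,q)| ≤ K(d,a)·(n+1)^{−d}·e^{−δ_PP|blk p − blk q|_∞}`, `|∇P| ≤ K′·(n+1)^{−(d+1)}·(same)`, and the road currency `|Pgt| ≲ n⁻⁴`, `|∇Pgt| ≲ n⁻⁵`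

HONEST FRAMING (cell contract, verbatim): «discharging `BetaPertH` makes Bałaban's UV stability UNCONDITIONAL — a real constructive-QFT
result; it is NOT the continuum limit and NOT the Clay problem.»  HONEST DEPENDENCY (verbatim): «continuum YM on T⁴ ⇐ BetaPertH ∧ nine
spine estimates (0/9 proved); BetaPertH ⇐ (D1) ∧ (D4) ∧ CAP+tail; G-an2-4 gates asym, D1 and NE2/3/4.»  THIS MODULE DISCHARGES NOTHING of
that: it is the leg-size input (kernel-checked, [folklore]) of ONE term class (A0 census row τ5 «R-jet block part `(∂D)PD*`, `D(∂P)D*`»,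
also «tad-blk») of ONE road to ONE conjunct (D1).  0 wall binders instantiated; NOT A3.a (the window count with these legs is the A3.a
seat's), NOT D1, NOT BetaPertH, NOT continuum, NOT Clay.
ABSOLUTE RULE (cell, verbatim): «No internally-minted statement may enter as a cited fact. Every hypothesis is either kernel-proved in this
package or a verbatim quotation of a PUBLISHED theorem with page reference.»  Nothing printed is asserted or cited; every theorem is proved
outright from leaf-09-g2's `D1BFx/RProjector` (`kerP`, `Pker`, `Pgt`, `deltaP`, `deltaPP`, `summable_kerP`, `summable_Pker`, `Pker_symm`),
leaf-05-g3's `D1BFx/RJetProjector` (`decays_of_blkBound`), pv23's `B6QGGQ278Zd` (`abs_Csq_le`) and parts 1–2 (`BlockColumnPoisson`,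
`BlockColumnSupNorm`: the mesh-free column legs `abs_gq_le_sup`, `abs_gq_diff_le_sup`, the convolution `abs_tsum_mul_le_of_decay`); two constants
WITH BODIES (`cPs`, `cPPs`) are the only definitions (no `def … : Prop`).

WHY (`HOME/b2b-balaban-beta-d1-p2/A0-TERM-CENSUS.md` v1 SIZES: «`P = Δ⁻¹Q′*(Q′Δ⁻²Q′*)⁻¹Q′Δ⁻¹` (B5 (1.70)) is a rank-one-per-block projector,
kernel `|P(x,y)| ≲ n^{−4}`, smooth at scale n»; WHAT A LEAF OWES (1) «B5 (1.70)/`B5Value126.PcT`-type bounds for P»; leaf-07 gen-2 HANDOFF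
«INFO for A3.a: `RProjector.abs_Pker_le`'s constant is O(1)·poly(n) — the census' `|P| ≲ n⁻⁴` is NOT in any landed ℤ⁴ file»).  J5.0's
`abs_Pker_le` has the right SHAPE (block-structured decay at rate `δ_PP`) but the constant `c_PP(d,n,a) = O(1)` uniformly in `n` — it does not
see that `P` has ONE dimension per block of `(n+1)^d` sites.  With the mesh-free column legs of part 2 the same two-convolution argument gives
the constant `(n+1)^{−d}` (and one more `(n+1)^{−1}` per difference): THE RATES ARE J5.0's (`δ_P`, `δ_PP`), ONLY THE CONSTANTS CHANGE, so every
consumer of `abs_Pker_le` / `abs_Pgt_le` / `decays_Pgt` can swap in the sharp twin by name.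

CONTENT ([folklore]; `d ≥ 3`, any mesh `n`, `a > 0`).  §1 `cPs`, **`abs_kerP_le_sup`** `|(G′Q′*C)(p,y)| ≤ cPs e^{−δ_P|blk p − y|}` (n-free; vs J5.0's
`c_P ∝ (n+1)^{d/2}`), **`abs_kerP_diff_le_sup`** (forward difference, factor `(n+1)⁻¹`).  §2 `cPPs`, **`abs_Pker_le_sup`**
`|P(p,q)| ≤ cPPs·((n+1)^d)⁻¹·e^{−δ_PP|blk p − blk q|}`, **`abs_Pker_diff_le_sup`** `|P(p+e_μ,q) − P(p,q)| ≤ cPPs·((n+1)^{d+1})⁻¹·e^{−δ_PP|blk p − blk q|}`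
and the right-slot form `abs_Pker_diff_right_le_sup` (by `Pker_symm`).  §3 road currency (`d = 4`, block side `n ≥ 1` as in `GhostLeg`/`Pgt`):
**`abs_Pgt_le_sup`** `|Pgt n a x y| ≤ cPPs(4,a)·n⁻⁴·e^{−δ_PP|blk x − blk y|}`, **`abs_Pgt_diff_le_sup`** `≤ cPPs(4,a)·n⁻⁵·(same)`, and the fine-`ℓ¹` socket
**`decays_Pgt_sup`** `Decays (Pgt n a) (cPPs(4,a) e^{δ_PP} / n⁴) (δ_PP/(4n))` — the sharp drop-in for leaf-05-g3's `RJetProjector.decays_Pgt`.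
HONEST SCOPE: scalar `U = 1` object on the whole lattice; constants existential in `d` (part 2's `cI d`), explicit in `a`; one difference per leg
(second differences would need third differences of the lattice Green function — not in lit1's library); the `q`-difference only through symmetry.
-/

namespace Summit.QuantumFields.BalabanUV.Beta.D1BFx.ProjectorSupNorm

open Finset Real
open Literature.MathematicalPhysics.QuantumFieldTheory.Balaban1983to89
open Literature.MathematicalPhysics.QuantumFieldTheory.Balaban1983to89.Beta.ExpKernelCalculus (MKer Decays)
open B4Sect5Proof (latticeConst latticeConst_nonneg)
open B6QGQLower276 (X e blk B mem_B)
open B6QGQDecay237 (cU deltaU cU_pos deltaU_pos deltaU_le_one)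
open B6QGGQ278Zd (Csq cC deltaC cC_pos deltaC_pos abs_Csq_le)
open B5Hk103ScalarZd (gq)
open GhostLeg (cast_pred_add_one)
open RProjector (kerP Pker Pgt Pgt_apply Pker_symm deltaP deltaPP deltaP_pos deltaPP_pos summable_kerP summable_Pker)
open RJetProjector (decays_of_blkBound)
open BlockColumnPoisson (dist_blk_add_e_le_one)
open BlockColumnSupNorm (cG cG_pos abs_gq_le_sup abs_gq_diff_le_sup abs_tsum_mul_le_of_decay)

noncomputable section

variable {d : ℕ}

/-! ## §1 `G′Q′*C`: sup-norm value and forward difference -/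

/-- [our object] **The sup-norm constant of `G′Q′*C`**: `cPs(d,a) = cG(d,a)·c_C·K_d(δ_C/2)` (no power of the mesh; compare `RProjector.cP`). -/
def cPs (d : ℕ) (a : ℝ) : ℝ := cG d a * cC d a * latticeConst d (deltaC d a / 2)

/-- [folklore] `cPs d a ≥ 0`. -/
theorem cPs_nonneg (d : ℕ) {a : ℝ} (ha : 0 < a) : 0 ≤ cPs d a := by
  unfold cPs; have := cG_pos d ha; have := cC_pos d ha
  have := latticeConst_nonneg d (half_pos (deltaC_pos d ha)).le; positivity

/-- [folklore] **SUP-NORM DECAY OF `G′Q′*C`**: `|(G′Q′*C)(p,y)| ≤ cPs(d,a)·e^{−δ_P|blk p − y|_∞}` at J5.0's rate `δ_P = min(δ_u,δ_C)/2`, with an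
`n`-FREE constant (J5.0's `abs_kerP_le` carries `c_P ∝ (n+1)^{d/2}`). -/
theorem abs_kerP_le_sup (hd : 3 ≤ d) (n : ℕ) {a : ℝ} (ha : 0 < a) (p y : X d) :
    |kerP n a p y| ≤ cPs d a * Real.exp (-(deltaP d a * dist (blk n p) y)) := by
  have h := abs_tsum_mul_le_of_decay (deltaU_pos d ha) (deltaC_pos d ha) (cG_pos d ha).le (cC_pos d ha).le
    (blk n p) y (fun y' => abs_gq_le_sup hd n ha p y') (fun y' => abs_Csq_le n ha y' y)
  rw [kerP]
  calc _ ≤ _ := h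
    _ = cPs d a * Real.exp (-(deltaP d a * dist (blk n p) y)) := by rw [cPs, deltaP]

/-- [folklore] **FORWARD DIFFERENCE OF `G′Q′*C` IN THE FINE SLOT**: `|(G′Q′*C)(p+e_μ,y) − (G′Q′*C)(p,y)| ≤ cPs(d,a)·(n+1)⁻¹·e^{−δ_P|blk p − y|_∞}`. -/
theorem abs_kerP_diff_le_sup (hd : 3 ≤ d) (n : ℕ) {a : ℝ} (ha : 0 < a) (p y : X d) (μ : Fin d) :
    |kerP n a (p + e μ) y - kerP n a p y| ≤ cPs d a / ((n : ℝ) + 1) * Real.exp (-(deltaP d a * dist (blk n p) y)) := by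
  have hsub : kerP n a (p + e μ) y - kerP n a p y = ∑' y' : X d, (gq n a (p + e μ) y' - gq n a p y') * Csq n a y' y := by
    rw [kerP, kerP, ← (summable_kerP n ha (p + e μ) y).tsum_sub (summable_kerP n ha p y)]
    refine tsum_congr fun y' => ?_
    ring
  have hK : 0 ≤ cG d a / ((n : ℝ) + 1) := div_nonneg (cG_pos d ha).le (by positivity)
  have h := abs_tsum_mul_le_of_decay (deltaU_pos d ha) (deltaC_pos d ha) hK (cC_pos d ha).le
    (blk n p) y (fun y' => abs_gq_diff_le_sup hd n ha p y' μ) (fun y' => abs_Csq_le n ha y' y)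
  rw [hsub]
  calc _ ≤ _ := h
    _ = cPs d a / ((n : ℝ) + 1) * Real.exp (-(deltaP d a * dist (blk n p) y)) := by rw [cPs, deltaP]; ring

/-! ## §2 The projector `P`: the sharp constant `(n+1)^{−d}` and the difference `(n+1)^{−(d+1)}` -/

/-- [our object] **The sup-norm constant of `P`**: `cPPs(d,a) = cPs(d,a)·cG(d,a)·K_d(δ_u/2)` (the factor `(n+1)^{−d}` of `Pker` is displayed separately). -/
def cPPs (d : ℕ) (a : ℝ) : ℝ := cPs d a * cG d a * latticeConst d (deltaU d a / 2)

/-- [folklore] `cPPs d a ≥ 0`. -/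
theorem cPPs_nonneg (d : ℕ) {a : ℝ} (ha : 0 < a) : 0 ≤ cPPs d a := by
  unfold cPPs; have := cPs_nonneg d ha; have := cG_pos d ha
  have := latticeConst_nonneg d (half_pos (deltaU_pos d ha)).le; positivity

/-- [folklore] **THE SHARP PROJECTOR BOUND — `P` HAS ONE DIMENSION PER BLOCK**: `|P(p,q)| ≤ cPPs(d,a)·((n+1)^d)⁻¹·e^{−δ_PP|blk p − blk q|_∞}` at J5.0's
rate `δ_PP` (compare `RProjector.abs_Pker_le`, constant `O(1)`): the A0 census size «`|P(x,y)| ≲ n^{−4}`» at `d = 4`. -/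
theorem abs_Pker_le_sup (hd : 3 ≤ d) (n : ℕ) {a : ℝ} (ha : 0 < a) (p q : X d) :
    |Pker n a p q| ≤ cPPs d a / ((n : ℝ) + 1) ^ d * Real.exp (-(deltaPP d a * dist (blk n p) (blk n q))) := by
  have hN : (0 : ℝ) < ((n : ℝ) + 1) ^ d := by positivity
  have h := abs_tsum_mul_le_of_decay (deltaP_pos d ha) (deltaU_pos d ha) (cPs_nonneg d ha) (cG_pos d ha).le
    (blk n p) (blk n q) (fun y => abs_kerP_le_sup hd n ha p y)
    (fun y => by rw [dist_comm]; exact abs_gq_le_sup hd n ha q y)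
  rw [Pker, abs_mul, abs_of_pos (inv_pos.2 hN)]
  calc (((n : ℝ) + 1) ^ d)⁻¹ * |∑' y : X d, kerP n a p y * gq n a q y|
      ≤ (((n : ℝ) + 1) ^ d)⁻¹ * (cPs d a * cG d a * latticeConst d (deltaU d a / 2)
          * Real.exp (-(min (deltaP d a) (deltaU d a) / 2 * dist (blk n p) (blk n q)))) :=
        mul_le_mul_of_nonneg_left h (inv_pos.2 hN).le
    _ = cPPs d a / ((n : ℝ) + 1) ^ d * Real.exp (-(deltaPP d a * dist (blk n p) (blk n q))) := by
        rw [cPPs, deltaPP, div_eq_mul_inv]; ring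

/-- [folklore] **`P` IS SMOOTH AT THE BLOCK SCALE** (forward difference in the left slot):
`|P(p+e_μ,q) − P(p,q)| ≤ cPPs(d,a)·((n+1)^{d+1})⁻¹·e^{−δ_PP|blk p − blk q|_∞}` — the census' «smooth at scale n» (`|∇P| ≲ n⁻⁵` at `d = 4`). -/
theorem abs_Pker_diff_le_sup (hd : 3 ≤ d) (n : ℕ) {a : ℝ} (ha : 0 < a) (p q : X d) (μ : Fin d) :
    |Pker n a (p + e μ) q - Pker n a p q|
      ≤ cPPs d a / ((n : ℝ) + 1) ^ (d + 1) * Real.exp (-(deltaPP d a * dist (blk n p) (blk n q))) := by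
  have hs : (0 : ℝ) < (n : ℝ) + 1 := by positivity
  have hN : (0 : ℝ) < ((n : ℝ) + 1) ^ d := by positivity
  have hsub : Pker n a (p + e μ) q - Pker n a p q
      = (((n : ℝ) + 1) ^ d)⁻¹ * ∑' y : X d, (kerP n a (p + e μ) y - kerP n a p y) * gq n a q y := by
    rw [Pker, Pker, ← mul_sub, ← (summable_Pker n ha (p + e μ) q).tsum_sub (summable_Pker n ha p q)]
    congr 1
    refine tsum_congr fun y => ?_
    ring
  have hK : 0 ≤ cPs d a / ((n : ℝ) + 1) := div_nonneg (cPs_nonneg d ha) hs.le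
  have h := abs_tsum_mul_le_of_decay (deltaP_pos d ha) (deltaU_pos d ha) hK (cG_pos d ha).le
    (blk n p) (blk n q) (fun y => abs_kerP_diff_le_sup hd n ha p y μ)
    (fun y => by rw [dist_comm]; exact abs_gq_le_sup hd n ha q y)
  rw [hsub, abs_mul, abs_of_pos (inv_pos.2 hN)]
  calc (((n : ℝ) + 1) ^ d)⁻¹ * |∑' y : X d, (kerP n a (p + e μ) y - kerP n a p y) * gq n a q y|
      ≤ (((n : ℝ) + 1) ^ d)⁻¹ * (cPs d a / ((n : ℝ) + 1) * cG d a * latticeConst d (deltaU d a / 2)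
          * Real.exp (-(min (deltaP d a) (deltaU d a) / 2 * dist (blk n p) (blk n q)))) :=
        mul_le_mul_of_nonneg_left h (inv_pos.2 hN).le
    _ = cPPs d a / ((n : ℝ) + 1) ^ (d + 1) * Real.exp (-(deltaPP d a * dist (blk n p) (blk n q))) := by
        rw [cPPs, deltaPP, pow_succ]
        field_simp

/-- [folklore] The forward difference in the RIGHT slot (by the symmetry `P(p,q) = P(q,p)`, J5.0's `Pker_symm`):
`|P(p,q+e_μ) − P(p,q)| ≤ cPPs(d,a)·((n+1)^{d+1})⁻¹·e^{−δ_PP|blk p − blk q|_∞}`. -/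
theorem abs_Pker_diff_right_le_sup (hd : 3 ≤ d) (n : ℕ) {a : ℝ} (ha : 0 < a) (p q : X d) (μ : Fin d) :
    |Pker n a p (q + e μ) - Pker n a p q|
      ≤ cPPs d a / ((n : ℝ) + 1) ^ (d + 1) * Real.exp (-(deltaPP d a * dist (blk n p) (blk n q))) := by
  rw [Pker_symm n ha p (q + e μ), Pker_symm n ha p q, dist_comm]
  exact abs_Pker_diff_le_sup hd n ha q p μ

/-! ## §3 Road currency (`d = 4`, block side `n ≥ 1` as in `D1BFx/GhostLeg`: `Pgt n a = Pker (n − 1) a`) -/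

/-- [folklore] **`|Pgt n a x y| ≤ cPPs(4,a)·n⁻⁴·e^{−δ_PP(4,a)|blk x − blk y|_∞}`** (blocks of side `n`) — the census size «`|P(x,y)| ≲ n^{−4}`», mesh-free
constant, J5.0's rate (compare `RProjector.abs_Pgt_le`). -/
theorem abs_Pgt_le_sup (n : ℕ) [NeZero n] {a : ℝ} (ha : 0 < a) (x y : X 4) (u v : Unit) :
    |Pgt n a x y u v| ≤ cPPs 4 a / (n : ℝ) ^ 4 * Real.exp (-(deltaPP 4 a * dist (blk (n - 1) x) (blk (n - 1) y))) := by
  have h := abs_Pker_le_sup (d := 4) (by norm_num) (n - 1) ha x y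
  rw [cast_pred_add_one n] at h
  rw [Pgt_apply]; exact h

/-- [folklore] **`|Pgt n a (x+e_μ) y − Pgt n a x y| ≤ cPPs(4,a)·n⁻⁵·e^{−δ_PP(4,a)|blk x − blk y|_∞}`** — the census' «smooth at scale n». -/
theorem abs_Pgt_diff_le_sup (n : ℕ) [NeZero n] {a : ℝ} (ha : 0 < a) (x y : X 4) (μ : Fin 4) (u v : Unit) :
    |Pgt n a (x + e μ) y u v - Pgt n a x y u v|
      ≤ cPPs 4 a / (n : ℝ) ^ 5 * Real.exp (-(deltaPP 4 a * dist (blk (n - 1) x) (blk (n - 1) y))) := by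
  have h := abs_Pker_diff_le_sup (d := 4) (by norm_num) (n - 1) ha x y μ
  rw [cast_pred_add_one n] at h
  rw [Pgt_apply, Pgt_apply]; exact h

/-- [folklore] The right-slot difference of `Pgt`: `|Pgt n a x (y+e_μ) − Pgt n a x y| ≤ cPPs(4,a)·n⁻⁵·e^{−δ_PP(4,a)|blk x − blk y|_∞}`. -/
theorem abs_Pgt_diff_right_le_sup (n : ℕ) [NeZero n] {a : ℝ} (ha : 0 < a) (x y : X 4) (μ : Fin 4) (u v : Unit) :
    |Pgt n a x (y + e μ) u v - Pgt n a x y u v|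
      ≤ cPPs 4 a / (n : ℝ) ^ 5 * Real.exp (-(deltaPP 4 a * dist (blk (n - 1) x) (blk (n - 1) y))) := by
  have h := abs_Pker_diff_right_le_sup (d := 4) (by norm_num) (n - 1) ha x y μ
  rw [cast_pred_add_one n] at h
  rw [Pgt_apply, Pgt_apply]; exact h

/-- [folklore] **THE SHARP FINE-`ℓ¹` SOCKET**: `Decays (Pgt n a) (cPPs(4,a)·e^{δ_PP}/n⁴) (δ_PP/(4n))` — the drop-in for leaf-05-g3's
`RJetProjector.decays_Pgt` (same rate `δ_PP/(4n)`, constant smaller by the block volume `n⁴`), through leaf-05-g3's `decays_of_blkBound`. -/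
theorem decays_Pgt_sup (n : ℕ) [NeZero n] {a : ℝ} (ha : 0 < a) :
    Decays (Pgt n a) (cPPs 4 a / (n : ℝ) ^ 4 * Real.exp (deltaPP 4 a)) (deltaPP 4 a / (4 * (n : ℝ))) := by
  have hn : (0 : ℝ) < (n : ℝ) := by exact_mod_cast Nat.pos_of_ne_zero (NeZero.ne n)
  have h := decays_of_blkBound (K := Pgt n a) (n - 1) (div_nonneg (cPPs_nonneg 4 ha) (pow_pos hn 4).le)
    (deltaPP_pos 4 ha).le (fun x y => abs_Pgt_le_sup n ha x y () ())
  rwa [cast_pred_add_one n] at h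

end

end Summit.QuantumFields.BalabanUV.Beta.D1BFx.ProjectorSupNorm
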